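import Summits.AnomalousDissipation.AnomalousDissipation.Theorems.SawtoothPulseCascadeK1LocalisedCascadeHalfStepV

/-!
# K1loc, line `Spectral` / thin start — helper: THE H HALF-STEP WINDOW INEQUALITY OF THE FIBRE LEDGER (integer strain)

Helper file of the prover lane on the crux `K1LocalisedCascade` (stmt-AnomalousDissipation-19491), route
`SawtoothPulseCascade` (S-D fibre ledger).  The twin of `…HalfStepV.sum_window_sq_norm_vstep_le` for the H half-step
`b = a ∘ Φ_H`, `Φ_H = shearMap 0 1 (γU_j)`: fibres `n = k₀` (preserved), window variable `k₁`, profile variable `x₁`, input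
cut-off `T_χ a = Σ_l χ(l) A¹_l a` in `k₁`, per-fibre mid-band symbols `ψ_n` with `ψ_n(±nγ) = 0`:
**`sum_window_sq_norm_hstep_le`** — `Σ_{k∈W} ‖𝓕(a ∘ Φ_H)(k)‖² ≤ ((∫|k_χ|)·√(ε² + (ε + 2A)²·(2N_j·4w)) + √(Σ_{n∈F} ∫‖A⁰_n(a − T_χ a)‖²))²`.
Same proof with the coordinates exchanged.  No definitions; no statement about the crux.
[cite: Grafakos2014, Prop. 3.1.2 (5) and Prop. 3.2.7 (3)] [cite: ElgindiLissMattingly2025, §1 (slope ±1 branches)] [problem: turb]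
-/

-- `Summit.<Summit>.<Problem>`: single-conjunct summit, the duplicate namespace segment is deliberate.
set_option linter.dupNamespace false

noncomputable section

namespace Summit.AnomalousDissipation.AnomalousDissipation.Theorems.SawtoothPulseCascade.K1Window

open MeasureTheory Set Filter Topology UnitAddTorus Function Complex Metric
open scoped Real ENNReal
open Literature.Analysis Literature.Analysis.FunctionSpaces Literature.Analysis.FunctionSpaces.Torus Literature.Analysis.FluidPDE
open Literature.Analysis.FluidPDE.ShearStage
open Literature.Analysis.FluidPDE.SawtoothCascade Literature.Analysis.FluidPDE.SawtoothCascade.CascadeParams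
open Summit.AnomalousDissipation.AnomalousDissipation.Theorems.SawtoothPulseCascade.K1Start
open Summit.AnomalousDissipation.AnomalousDissipation.Theorems.SawtoothPulseCascade.K1Flat

/-! ## The H half-step window inequality -/

/-- **THE H HALF-STEP WINDOW INEQUALITY** (see the file header for the shape and the meaning of the data).  Integer strain
`γ = G`; `b = a ∘ shearMap 0 1 (γU_j)`; fibres `n = k₀`, window variable `k₁`; `T_χ a = Σ_l χ(l) A¹_l a` the input cut-off (in `k₁`).
[cite: Grafakos2014, Prop. 3.1.2 (5) and Prop. 3.2.7 (3)] [cite: ElgindiLissMattingly2025, §1 (slope ±1 branches)] -/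
theorem sum_window_sq_norm_hstep_le (P : CascadeParams) {G : ℕ} (hγ : P.γ = G) (hδ₀ : 0 < P.δ₀) (hd : 0 < P.d)
    (hN₀ : 1 ≤ P.N₀) (hρN : 1 ≤ P.ρN) (j : ℕ)
    {b : UnitAddTorus (Fin 2) → ℂ} (hb : Continuous b) (hbs : Summable fun k => ‖mFourierCoeff b k‖) (hb1 : ∀ x, ‖b x‖ ≤ 1)
    (W : Finset (Fin 2 → ℤ)) (χ : ℤ → ℂ) (Sχ : Finset ℤ) (hχS : ∀ l, l ∉ Sχ → χ l = 0) (hχ1 : ∀ l, ‖χ l‖ ≤ 1) (L : ℕ)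
    (hχL : ∀ l, χ l ≠ 0 → |l| < L) (ψ : ℤ → ℤ → ℂ) (Sψ : ℤ → Finset ℤ) (hψS : ∀ n m, m ∉ Sψ n → ψ n m = 0)
    (hψ0 : ∀ k ∈ W, ψ (k 0) (k 0 * G) = 0 ∧ ψ (k 0) (-(k 0 * G)) = 0)
    (hψ1 : ∀ k ∈ W, ∀ l : ℤ, |l| < L → ψ (k 0) (k 1 - l) = 1)
    {w M ε A : ℝ} (hw : 0 < w) (hM : 1 ≤ M) (hMδ : M * P.δ j < π / 2) (hMw : M * P.δ j < 2 * π * P.N j * w) (hA0 : 0 ≤ A)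
    (hA : ∀ k ∈ W, (∫ s : UnitAddCircle, ‖∑ m ∈ Sψ (k 0), ψ (k 0) m * fourier (-m) s‖) + 2 ≤ A) (hε0 : 0 ≤ ε)
    (hε : ∀ k ∈ W, 2 * (2 * ∫ s in {s : UnitAddCircle | w / 2 ≤ ‖s‖}, ‖∑ m ∈ Sψ (k 0), ψ (k 0) m * fourier (-m) s‖) +
      2 * π * |((k 0 * G : ℤ) : ℝ)| * (Real.exp (-(M ^ 2 / 2)) / (2 * P.N j)) ≤ ε) :
    ∑ k ∈ W, ‖mFourierCoeff (b ∘ shearMap 0 1 (amp ⟨P.U j, P.U_periodic j, P.contDiff_U (P.δ_pos hδ₀ hd j)⟩ P.γ)) k‖ ^ 2 ≤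
      ((∫ s : UnitAddCircle, ‖∑ l ∈ Sχ, χ l * fourier (-l) s‖) *
          Real.sqrt (ε ^ 2 + (ε + 2 * A) ^ 2 * (2 * P.N j * (2 * (2 * w)))) +
        Real.sqrt (∑ n ∈ W.image (fun k => k 0), ∫ x : UnitAddTorus (Fin 2),
          ‖∫ s : UnitAddCircle, (fourier (-n) s : ℂ) •
            (b (x + Pi.single (0 : Fin 2) s) - ∑ l ∈ Sχ, χ l * ∫ s' : UnitAddCircle,
              (fourier (-l) s' : ℂ) • b (x + Pi.single (0 : Fin 2) s + Pi.single (1 : Fin 2) s'))‖ ^ 2)) ^ 2 := by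
  classical
  have h10 : (0 : Fin 2) ≠ 1 := by decide
  have hπ : 0 < π := Real.pi_pos
  have hN : P.N j ≠ 0 := (N_pos P hN₀ hρN j).ne'
  have hNpos : 0 < P.N j := Nat.pos_of_ne_zero hN
  have hNr : (0 : ℝ) < P.N j := by exact_mod_cast hNpos
  have hc : 0 < 2 * π * (P.N j : ℝ) := by positivity
  set Ψ : ShearProfile := amp ⟨P.U j, P.U_periodic j, P.contDiff_U (P.δ_pos hδ₀ hd j)⟩ P.γ with hΨ
  have hΨt : ∀ t : ℝ, Ψ t = P.γ * P.U j t := fun t => amp_apply _ _ _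
  -- the input cut-off and its complement
  set T : UnitAddTorus (Fin 2) → ℂ := fun x => ∑ l ∈ Sχ, χ l *
    ∫ s : UnitAddCircle, (fourier (-l) s : ℂ) • b (x + Pi.single (1 : Fin 2) s) with hT
  have hTc : Continuous T := continuous_finsetSum _ fun l _ => continuous_const.mul (continuous_twistedAxisAvg hb 1 l)
  have hTcoef : ∀ k, mFourierCoeff T k = χ (k 1) * mFourierCoeff b k := fun k => mFourierCoeff_axisCutoff hb 1 hχS k
  have hTs : Summable fun k => ‖mFourierCoeff T k‖ := by
    refine Summable.of_nonneg_of_le (fun k => norm_nonneg _) (fun k => ?_) hbs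
    rw [hTcoef k, norm_mul]
    exact mul_le_of_le_one_left (norm_nonneg _) (hχ1 _)
  set θ₂ : UnitAddTorus (Fin 2) → ℂ := fun x => b x - T x with hθ₂
  have hθ₂c : Continuous θ₂ := hb.sub hTc
  have hsum : (fun x => T x + θ₂ x) = b := by funext x; simp [hθ₂]
  -- the exact chirps, the circle kernels, the chirp split
  set g0 : ℤ → UnitAddCircle → ℂ := fun n => (periodic_exactChirpFun (P.N j) (n * G)).lift with hg0
  have hg0c : ∀ n, Continuous (g0 n) := fun n => (continuous_exactChirp_lift (P.N j) (n * G)).1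
  have hg0t : ∀ n (t : ℝ), g0 n (t : UnitAddCircle) =
      Complex.exp (-(2 * π * I * ((n * G : ℤ)) * ((tri (2 * π * P.N j * t) / (2 * π * P.N j) : ℝ) : ℂ))) :=
    fun n t => (continuous_exactChirp_lift (P.N j) (n * G)).2 t
  have hg01 : ∀ n bb, ‖g0 n bb‖ ≤ 1 := by
    intro n bb
    obtain ⟨t, rfl⟩ := QuotientAddGroup.mk_surjective bb
    rw [hg0t]; exact norm_exp_chirp_le _ _
  set kψ : ℤ → UnitAddCircle → ℂ := fun n s => ∑ m ∈ Sψ n, ψ n m * fourier (-m) s with hkψ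
  have hkψc : ∀ n, Continuous (kψ n) := fun n =>
    continuous_finsetSum _ fun m _ => continuous_const.mul (fourier (-m)).continuous
  set gmid : ℤ → UnitAddCircle → ℂ := fun n bb => (∫ s : UnitAddCircle, kψ n s * g0 n (bb + s)) + (twist Ψ n bb - g0 n bb)
    with hgmid
  set grest : ℤ → UnitAddCircle → ℂ := fun n bb => g0 n bb - ∫ s : UnitAddCircle, kψ n s * g0 n (bb + s) with hgrest
  have hgmidc : ∀ n, Continuous (gmid n) := fun n =>
    (continuous_circleCutoff (hkψc n) (hg0c n)).add ((continuous_twist Ψ n).sub (hg0c n))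
  have hgrestc : ∀ n, Continuous (grest n) := fun n => (hg0c n).sub (continuous_circleCutoff (hkψc n) (hg0c n))
  have hsplit : ∀ k ∈ W, ∀ bb, twist Ψ (k 0) bb = gmid (k 0) bb + grest (k 0) bb := by
    intro k _ bb; simp only [hgmid, hgrest]; ring
  -- exact separation
  have hsep : ∀ k ∈ W, ∀ m : ℤ, fourierCoeff (grest (k 0)) m * mFourierCoeff T (k - Pi.single 1 m) = 0 := by
    intro k hk m
    rw [hTcoef]
    have e0 : (k - Pi.single (1 : Fin 2) m : Fin 2 → ℤ) 1 = k 1 - m := by simp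
    rw [e0]
    by_cases hχ0 : χ (k 1 - m) = 0
    · rw [hχ0, zero_mul, mul_zero]
    · have hl : |k 1 - m| < L := hχL _ hχ0
      have hψm : ψ (k 0) m = 1 := by
        have := hψ1 k hk (k 1 - m) hl
        rwa [show k 1 - (k 1 - m) = m by ring] at this
      have hcoef : fourierCoeff (grest (k 0)) m = 0 := by
        simp only [hgrest]
        rw [fourierCoeff_sub_of_continuous (hg0c _) (continuous_circleCutoff (hkψc _) (hg0c _)),
          show (fun y : UnitAddCircle => ∫ s : UnitAddCircle, kψ (k 0) s * g0 (k 0) (y + s)) =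
            (fun y : UnitAddCircle => ∫ s : UnitAddCircle, (∑ m' ∈ Sψ (k 0), ψ (k 0) m' * fourier (-m') s) * g0 (k 0) (y + s))
            from rfl,
          fourierCoeff_circleCutoff (hg0c _) (hψS (k 0)) m, hψm, one_mul, sub_self]
      rw [hcoef, zero_mul]
  -- the corner set, the majorant
  set C : Set UnitAddCircle := (((Finset.Ico (0 : ℤ) (2 * P.N j)).image
      fun l : ℤ => (((2 * (l : ℝ) + 1) / (4 * P.N j) : ℝ) : UnitAddCircle)) : Set UnitAddCircle) with hC
  set ρ : UnitAddCircle → ℝ := fun bb => ε + 2 * A * max 0 (1 - infDist bb C / (2 * w)) with hρ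
  have hρc : Continuous ρ := continuous_const.add (continuous_const.mul (continuous_tent C (2 * w)))
  have hρ0 : ∀ bb, 0 ≤ ρ bb := fun bb => by
    have := (tent_nonneg_le_one C (by positivity : 0 < 2 * w) bb).1
    simp only [hρ]; positivity
  have hbd : ∀ k ∈ W, ∀ bb, ‖gmid (k 0) bb‖ ≤ ρ bb := by
    intro k hk bb
    have hkA := hA k hk
    have hkε := hε k hk
    have hkψ1 : (∫ s : UnitAddCircle, ‖kψ (k 0) s‖) + 2 ≤ A := by simpa only [hkψ] using hkA
    by_cases hnear : infDist bb C < w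
    · -- on the layer: the crude bound `A`
      have h1 : ‖∫ s : UnitAddCircle, kψ (k 0) s * g0 (k 0) (bb + s)‖ ≤ (∫ s : UnitAddCircle, ‖kψ (k 0) s‖) * 1 :=
        norm_circleCutoff_le (hkψc _) (hg0c _) (hg01 _) bb
      have h2 : ‖twist Ψ (k 0) bb - g0 (k 0) bb‖ ≤ 2 := by
        refine (norm_sub_le _ _).trans ?_
        have := hg01 (k 0) bb
        rw [norm_twist]; linarith
      have h3 : ‖gmid (k 0) bb‖ ≤ A := by
        simp only [hgmid]
        refine (norm_add_le _ _).trans ?_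
        linarith
      have h4 := half_le_tent_of_infDist_lt C hw hnear
      have : A ≤ ρ bb := by
        simp only [hρ]
        nlinarith
      exact h3.trans this
    · -- off the layer: orthogonality + kernel tail, and the rounding remainder
      push Not at hnear
      obtain ⟨t, rfl⟩ := QuotientAddGroup.mk_surjective bb
      have hfar := phase_far_of_le_infDist hNpos hnear
      have hfar1 : ∀ m : ℤ, π * P.N j * w < |2 * π * P.N j * t - (π / 2 + π * m)| := fun m =>
        lt_of_lt_of_le (by nlinarith [mul_pos (mul_pos hπ hNr) hw]) (hfar m)
      have hfar2 : ∀ m : ℤ, M * P.δ j < |2 * π * P.N j * t - (π / 2 + π * m)| := fun m =>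
        lt_of_lt_of_le hMw (hfar m)
      -- mid-band part of the exact chirp
      have h1 := norm_circleCutoff_exactChirp_le hNpos (hg0c (k 0)) (hg0t (k 0)) (Sψ (k 0)) (hψ0 k hk).1 (hψ0 k hk).2 hfar1
      have hr : π * ↑(P.N j) * w / (2 * π * ↑(P.N j)) = w / 2 := by field_simp
      rw [hr] at h1
      have h1' : ‖∫ s : UnitAddCircle, kψ (k 0) s * g0 (k 0) ((t : UnitAddCircle) + s)‖ ≤
          2 * ∫ s in {s : UnitAddCircle | w / 2 ≤ ‖s‖}, ‖kψ (k 0) s‖ := by simpa only [hkψ] using h1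
      have hkε' : 2 * (2 * ∫ s in {s : UnitAddCircle | w / 2 ≤ ‖s‖}, ‖kψ (k 0) s‖) +
          2 * π * |((k 0 * G : ℤ) : ℝ)| * (Real.exp (-(M ^ 2 / 2)) / (2 * P.N j)) ≤ ε := by simpa only [hkψ] using hkε
      -- rounding remainder
      have hU := abs_U_sub_tri_le_of_far P hδ₀ hd hN₀ hρN hM hMδ hfar2
      have h2 : ‖twist Ψ (k 0) ((t : ℝ) : UnitAddCircle) - g0 (k 0) (t : UnitAddCircle)‖ ≤
          2 * π * |((k 0 * G : ℤ) : ℝ)| * (Real.exp (-(M ^ 2 / 2)) / (2 * P.N j)) := by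
        rw [twist_coe, hΨt, hγ, hg0t]
        have e1 : -(2 * ↑π * I * ((k 0 : ℤ) : ℂ) * (((G : ℝ) * P.U j t : ℝ) : ℂ)) =
            -(2 * π * I * (((k 0 * G : ℤ) : ℝ) : ℂ) * ((P.U j t : ℝ) : ℂ)) := by push_cast; ring
        have e2 : -(2 * ↑π * I * ((k 0 * G : ℤ) : ℂ) * ((tri (2 * π * P.N j * t) / (2 * π * P.N j) : ℝ) : ℂ)) =
            -(2 * π * I * (((k 0 * G : ℤ) : ℝ) : ℂ) * ((tri (2 * π * P.N j * t) / (2 * π * P.N j) : ℝ) : ℂ)) := by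
          push_cast; ring
        rw [e1, e2]
        refine (norm_exp_chirp_sub_le _ _ _).trans ?_
        exact mul_le_mul_of_nonneg_left hU (by positivity)
      have hT0 : 0 ≤ ∫ s in {s : UnitAddCircle | w / 2 ≤ ‖s‖}, ‖kψ (k 0) s‖ := integral_nonneg fun _ => norm_nonneg _
      have h3 : ‖gmid (k 0) (t : UnitAddCircle)‖ ≤ ε := by
        simp only [hgmid]
        refine (norm_add_le _ _).trans ?_
        linarith [h1', h2, hkε', hT0]
      have : ε ≤ ρ (t : UnitAddCircle) := by
        have := (tent_nonneg_le_one C (by positivity : 0 < 2 * w) (t : UnitAddCircle)).1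
        simp only [hρ]; nlinarith
      exact h3.trans this
  -- the window lemma
  have hmain := sum_window_sq_norm_comp_shearMap_le_fibre hTc hTs hθ₂c h10 Ψ W gmid grest hgmidc hgrestc hsplit hsep hρc hρ0 hbd
  rw [hsum] at hmain
  refine hmain.trans (pow_le_pow_left₀ (by positivity) (add_le_add ?_ le_rfl) 2)
  -- the zone term: sup norm × kernel `L¹` norm × layer mass
  have hZ : ∫ x : UnitAddTorus (Fin 2), ρ (x 1) ^ 2 * ‖T x‖ ^ 2 ≤
      (∫ s : UnitAddCircle, ‖∑ l ∈ Sχ, χ l * fourier (-l) s‖) ^ 2 * 1 ^ 2 * ∫ bb : UnitAddCircle, ρ bb ^ 2 :=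
    integral_weight_mul_norm_axisCutoff_sq_le hb hb1 1 χ Sχ hρc
  have hρ2 : ∫ bb : UnitAddCircle, ρ bb ^ 2 ≤ ε ^ 2 + (ε + 2 * A) ^ 2 * (2 * P.N j * (2 * (2 * w))) :=
    integral_majorant_sq_le hNpos (by positivity : 0 < 2 * w) hε0 (by positivity : 0 ≤ 2 * A)
  have hK0 : 0 ≤ ∫ s : UnitAddCircle, ‖∑ l ∈ Sχ, χ l * fourier (-l) s‖ := integral_nonneg fun s => norm_nonneg _
  calc Real.sqrt (∫ x : UnitAddTorus (Fin 2), ρ (x 1) ^ 2 * ‖T x‖ ^ 2)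
      ≤ Real.sqrt ((∫ s : UnitAddCircle, ‖∑ l ∈ Sχ, χ l * fourier (-l) s‖) ^ 2 *
          (ε ^ 2 + (ε + 2 * A) ^ 2 * (2 * P.N j * (2 * (2 * w))))) := by
        refine Real.sqrt_le_sqrt (hZ.trans ?_)
        rw [one_pow, mul_one]
        exact mul_le_mul_of_nonneg_left hρ2 (sq_nonneg _)
    _ = (∫ s : UnitAddCircle, ‖∑ l ∈ Sχ, χ l * fourier (-l) s‖) *
          Real.sqrt (ε ^ 2 + (ε + 2 * A) ^ 2 * (2 * P.N j * (2 * (2 * w)))) := by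
        rw [Real.sqrt_mul (sq_nonneg _), Real.sqrt_sq hK0]

end Summit.AnomalousDissipation.AnomalousDissipation.Theorems.SawtoothPulseCascade.K1Window
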